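import Literature.MathematicalPhysics.QuantumFieldTheory.Balaban1983to89.Beta.WilsonWard22
import Literature.MathematicalPhysics.QuantumFieldTheory.Balaban1983to89.Beta.PlaquetteVertex2

/-!
# `BalabanUV.Beta.WilsonFluctuationWard22` — the FLUCTUATION-gauge Ward identity of the Wilson plaquette jets at order `(W², B²)`,
# LATTICE-SUMMED: an3's all-letters identity (E₂) `WilsonWard22.ward22` read on the fields of a finite lattice
# (road «FP», binder row D1, (J-a) (β) row `a2` at level 0 — file (R1) of the kernel route to the fluctuation-LEG pure-gauge law of the
# Wilson bi-stencil `wilsonW₂ d ((8N²)⁻¹ • wsym22 N)` and to the torus row `torus_a2_wilson`; D1 formalisation swarm seat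
# `b2b-balaban-beta-d1-formalise-leaf-05`, gen 35)

HONEST FRAMING (cell charter, verbatim): «discharging `BetaPertH` makes Bałaban's UV stability UNCONDITIONAL — a real
constructive-QFT result; it is NOT the continuum limit and NOT the Clay problem.»  HONEST DEPENDENCY (cell records, verbatim):
«continuum YM on T⁴ ⇐ BetaPertH ∧ nine spine estimates (0/9 proved); BetaPertH ⇐ (D1) ∧ (D4) ∧ CAP+tail; G-an2-4 gates asym, D1 and
NE2/3/4.»  DERIVED cell leaf: [folklore] multilinear algebra in an arbitrary normed algebra over an arbitrary finite abelian lattice — no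
estimate, no limit, nothing cited, no `[cite:]` tag, no `def`, no `def … : Prop`; every statement is kernel-proved here from an3's
`WilsonWard22.ward22` and the jet bookkeeping of `PlaquetteVertex`∕`PlaquetteVertex2`∕`WilsonWardJets`∕`WilsonWardJets2` BY NAME.  By itself
this file instantiates NO binder of the β-function wall and NO row of the door.  NOT D1, NOT `BetaPertH`, NOT continuum, NOT Clay.
«not in print; our bookkeeping».
ABSOLUTE RULE (cell charter, verbatim): «No internally-minted statement may enter as a cited fact. Every hypothesis is either
kernel-proved in this package or a verbatim quotation of a PUBLISHED theorem with page reference. The manuscript(s) under audit are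
NOT citable for their own disputed steps — they are the thing under adjudication; programme-internal (2001/route/tribunal) claims are
never citable.»

## What and why

The graded torus door of road «FP» (leaf-02's U21 `FP/NestedStepLawTorusTransportedRowsGradedLevelZeroSymULowClosedLamW2Q2`) displays the
ORDER-2 Ward row `a2 : H₂·[D₂|D₁] + 2•(H₁·W₁) + H₀·W₂ = −2•(𝔔₁ᵀ·Y₁) + 𝔔₀ᵀ·Y₂` between PINNED tables; its Wilson sector needs the pure-gauge law
of an3's second-order bi-stencil `WilsonBiStencil.wilsonW₂` on a FLUCTUATION (table) leg — the twin, one order up, of gan24-leaf-02's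
`GAN24.WilsonGaugeLegContact.gaugeLeg_wilsonA_inl_inl` and, one slot across, of leaf-09's `WilsonBiStencilWardZ.divV_wilsonW₂_wsym22_eq_conjV`
(the INDEX-leg law).  Its ring-level source is an3's per-plaquette, all-letters identity (E₂) `WilsonWard22.ward22`
(chart `U_b = e^{W_b}·e^{B_b}` of [Balaban1985BackgroundPropagators] (3.1) p. 390 = `WilsonVertex.plaq`; corners `x₁ → x₂ → x₃ ← x₄ ← x₁`):

  `4·Pol F_{2,2}(h, W₀λ) + 4·Pol F_{2,1}(h, W₁(B)λ) + 2·Pol F_{2,0}(h, 2W₂(B)λ) = 2·F_{1,2}(N₀(h)λ) + 2·F_{1,1}(N₁(h)λ)`      (E₂)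

(`W₀λ_b = λ(b₋) − λ(b₊)`, `W₁(B)λ_b = −[B_b, λ(b₊)]`, `2W₂(B)λ_b = [B_b, W₁(B)λ_b]`, `N₀(h)λ_b = [h_b, λ(b₋) + λ(b₊)]`, `N₁(h)λ_b = [W₁(B)λ_b, h_b]`).
THIS FILE sums (E₂) over all sites and all ordered direction pairs of a finite lattice `Λ` with frame `e` (the pattern of an3's
`WilsonWardJets.jet21_ward` ∕ `WilsonWardJets2.jet12_ward`): with an3's letter fields `WilsonWardJets.gaugeDir₀ e λ` (`W₀λ`), `gaugeDir₁ e B λ`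
(`W₁(B)λ`), `currArg₀ e h λ` (`N₀(h)λ`) and the two order-`B²` letter fields written INLINE (no `def`): the doubled second gauge direction
`(x, μ) ↦ B_μ(x)·(W₁(B)λ)_μ(x) − (W₁(B)λ)_μ(x)·B_μ(x)` (`2W₂(B)λ`) and the first-order current argument `(x, μ) ↦ (W₁(B)λ)_μ(x)·h_μ(x) − h_μ(x)·(W₁(B)λ)_μ(x)`
(`N₁(h)λ`):
* `ward22_plaqWord` — (E₂) at the lattice plaquette `p_{μν}(x)`: the fields read on its boundary ARE the free letters of `ward22` (far corner
  `x + e_ν + e_μ = x + e_μ + e_ν`; the `N₀` letters of `ward22` and of `currArg₀` differ by `a·(b + c) − (b + c)·a = (a·b − b·a) + (a·c − c·a)`,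
  re-associated bond by bond, tip-first on the bond `b₃`);
* **`jet22_flucWard`** — `4•[jet22(h + W₀λ; B) − jet22(h; B) − jet22(W₀λ; B)] + 4•[jet21(h + W₁λ; B) − jet21(h; B) − jet21(W₁λ; B)]`
  `+ 2•[jet20(h + 2W₂λ; B) − jet20(h; B) − jet20(2W₂λ; B)] = 2•jet12(N₀(h)λ; B) + 2•jet11(N₁(h)λ; B)` for every background `B`, every `h`, every
  site field `λ`, every ring and every tracial `τ` (an3's `PlaquetteVertex2.jet22`, `PlaquetteVertex.jet21`∕`jet20`, `WilsonWardJets2.jet12`,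
  `WilsonWardJets.jet11`).
NOT HERE (sequels (R2)–(R4) of the same intent): the coordinate ∕ colour-trace reading (`hess22`, `wilsonVertexOp`, an3's `sum_K22_diag`), the
transfer to `ℤ^{d+1}` (`gaugeLeg_wilsonW₂_wsym22_inl_inl`), the torus periodisation and `torus_a2_wilson`.  PROVENANCE of the shape (not used in
proofs): invariance of `τ(U(∂p))` under `U_b ↦ u(x_{b₋}) U_b u(x_{b₊})⁻¹`, `u = e^{λ}`, first variation in `W` at `W = h`, `B`-degree two.
Provenance: pub-balaban β sub-cell, D1 formalisation swarm, unit `b2b-balaban-beta-d1-formalise-leaf-05` gen 35, 2026-08-23 (v1); over an3's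
`WilsonWard22` ∕ `WilsonWardJets` ∕ `WilsonWardJets2` ∕ `PlaquetteVertex2` BY NAME; no existing file touched.
-/

namespace Summit.QuantumFields.BalabanUV.Beta.WilsonFluctuationWard22

open Finset
open scoped BigOperators
open Literature.MathematicalPhysics.QuantumFieldTheory.Balaban1983to89.Beta.TransportVertices
open Literature.MathematicalPhysics.QuantumFieldTheory.Balaban1983to89.Beta.WilsonVertex
open Literature.MathematicalPhysics.QuantumFieldTheory.Balaban1983to89.Beta.WilsonVertex2
open Literature.MathematicalPhysics.QuantumFieldTheory.Balaban1983to89.Beta.WilsonWard22 (ward22)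
open Literature.MathematicalPhysics.QuantumFieldTheory.Balaban1983to89.Beta.PlaquetteVertex (plaqWord jet21 jet20)
open Literature.MathematicalPhysics.QuantumFieldTheory.Balaban1983to89.Beta.PlaquetteVertex2 (jet22)
open Literature.MathematicalPhysics.QuantumFieldTheory.Balaban1983to89.Beta.WilsonWardJets (gaugeDir₀ gaugeDir₁ currArg₀ jet11)
open Literature.MathematicalPhysics.QuantumFieldTheory.Balaban1983to89.Beta.WilsonWardJets2 (jet12)

section Lattice

variable (𝕜 : Type*) [RCLike 𝕜] {𝔸 : Type*} [NormedRing 𝔸] [NormedAlgebra 𝕜 𝔸]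
variable {V : Type*} [AddCommGroup V] [Module 𝕜 V]
variable {Λ : Type*} [Fintype Λ] [AddCommGroup Λ] {D : Type*} [Fintype D]

omit [Fintype Λ] [Fintype D] in
/-- [folklore] **(E₂) AT THE LATTICE PLAQUETTE `p_{μν}(x)`**: an3's `ward22` with its sixteen free letters read from the fields — `h`, `B` on the
four bonds `(x,μ), (x+e_μ,ν), (x+e_ν,μ), (x,ν)`, `λ` at the four corners `x, x+e_μ, x+e_μ+e_ν, x+e_ν`; the gauge directions `W₀λ = gaugeDir₀ e λ`,
`W₁(B)λ = gaugeDir₁ e B λ`, the doubled second direction `2W₂(B)λ = B·(W₁λ) − (W₁λ)·B` (inline), the current arguments `N₀(h)λ = currArg₀ e h λ` and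
`N₁(h)λ = (W₁λ)·h − h·(W₁λ)` (inline). -/
theorem ward22_plaqWord (τ : 𝔸 →ₗ[𝕜] V) (hτ : ∀ a b : 𝔸, τ (a * b) = τ (b * a)) (e : D → Λ) (h B : Λ → D → 𝔸) (lam : Λ → 𝔸)
    (x : Λ) (μ ν : D) :
    (4 : 𝕜) • τ (P22 𝕜 (plaqWord e (h + gaugeDir₀ e lam) B x μ ν)) - (4 : 𝕜) • τ (P22 𝕜 (plaqWord e h B x μ ν))
      - (4 : 𝕜) • τ (P22 𝕜 (plaqWord e (gaugeDir₀ e lam) B x μ ν))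
      + ((4 : 𝕜) • τ (P21 𝕜 (plaqWord e (h + gaugeDir₁ e B lam) B x μ ν)) - (4 : 𝕜) • τ (P21 𝕜 (plaqWord e h B x μ ν))
          - (4 : 𝕜) • τ (P21 𝕜 (plaqWord e (gaugeDir₁ e B lam) B x μ ν)))
      + ((2 : 𝕜) • τ (quad 𝕜 (wpart (plaqWord e
            (h + fun y κ => B y κ * gaugeDir₁ e B lam y κ - gaugeDir₁ e B lam y κ * B y κ) B x μ ν)))
          - (2 : 𝕜) • τ (quad 𝕜 (wpart (plaqWord e h B x μ ν)))
          - (2 : 𝕜) • τ (quad 𝕜 (wpart (plaqWord e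
            (fun y κ => B y κ * gaugeDir₁ e B lam y κ - gaugeDir₁ e B lam y κ * B y κ) B x μ ν)))) =
      (2 : 𝕜) • τ (P12 𝕜 (plaqWord e (currArg₀ e h lam) B x μ ν))
        + (2 : 𝕜) • τ (P11 (plaqWord e (fun y κ => gaugeDir₁ e B lam y κ * h y κ - h y κ * gaugeDir₁ e B lam y κ) B x μ ν)) := by
  -- the `N₀` letters: `currArg₀` collects `[h, λ₋ + λ₊]`, `ward22` writes `[h, λ₋] + [h, λ₊]` (tip-first on the bond `(x + e_ν, μ)`)
  have e1 : ∀ a b c : 𝔸, a * (b + c) - (b + c) * a = a * b - b * a + (a * c - c * a) := by intros; noncomm_ring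
  have e2 : ∀ a b c : 𝔸, a * (b + c) - (b + c) * a = a * c - c * a + (a * b - b * a) := by intros; noncomm_ring
  simp only [plaqWord, Pi.add_apply, gaugeDir₀, gaugeDir₁, currArg₀]
  rw [add_right_comm x (e ν) (e μ), e1 (h x μ), e1 (h (x + e μ) ν), e2 (h (x + e ν) μ), e1 (h x ν)]
  exact ward22 𝕜 τ (B x μ) (B (x + e μ) ν) (B (x + e ν) μ) (B x ν) (h x μ) (h (x + e μ) ν) (h (x + e ν) μ) (h x ν)
    (lam x) (lam (x + e μ)) (lam (x + e μ + e ν)) (lam (x + e ν)) hτ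

/-- [folklore] **`jet22_flucWard` — THE FLUCTUATION-GAUGE WARD IDENTITY OF THE WILSON JETS AT ORDER `(W², B²)`, SUMMED OVER THE LATTICE**
(every finite abelian `Λ` with frame `e`, every normed algebra, every `𝕜`-linear tracial `τ`, every background `B`, fluctuation `h` and site field `λ`):
`4•[jet22(h + W₀λ; B) − jet22(h; B) − jet22(W₀λ; B)] + 4•[jet21(h + W₁(B)λ; B) − jet21(h; B) − jet21(W₁(B)λ; B)]`
`+ 2•[jet20(h + 2W₂(B)λ; B) − jet20(h; B) − jet20(2W₂(B)λ; B)] = 2•jet12(N₀(h)λ; B) + 2•jet11(N₁(h)λ; B)`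
— the `W`-polarised Hessian jets of `B`-degree `2, 1, 0` along the chart's gauge directions of `B`-degree `0, 1, 2` equal the `W`-linear currents of
`B`-degree `2, 1` on the current arguments `[h, λ₋ + λ₊]`, `[W₁(B)λ, h]`; the sum of `ward22_plaqWord` (an3's `ward22` BY NAME). -/
theorem jet22_flucWard (τ : 𝔸 →ₗ[𝕜] V) (hτ : ∀ a b : 𝔸, τ (a * b) = τ (b * a)) (e : D → Λ) (h B : Λ → D → 𝔸) (lam : Λ → 𝔸) :
    (4 : 𝕜) • (jet22 𝕜 τ e (h + gaugeDir₀ e lam) B - jet22 𝕜 τ e h B - jet22 𝕜 τ e (gaugeDir₀ e lam) B)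
      + (4 : 𝕜) • (jet21 𝕜 τ e (h + gaugeDir₁ e B lam) B - jet21 𝕜 τ e h B - jet21 𝕜 τ e (gaugeDir₁ e B lam) B)
      + (2 : 𝕜) • (jet20 𝕜 τ e (h + fun y κ => B y κ * gaugeDir₁ e B lam y κ - gaugeDir₁ e B lam y κ * B y κ) B - jet20 𝕜 τ e h B
          - jet20 𝕜 τ e (fun y κ => B y κ * gaugeDir₁ e B lam y κ - gaugeDir₁ e B lam y κ * B y κ) B) =
      (2 : 𝕜) • jet12 𝕜 τ e (currArg₀ e h lam) B
        + (2 : 𝕜) • jet11 𝕜 τ e (fun y κ => gaugeDir₁ e B lam y κ * h y κ - h y κ * gaugeDir₁ e B lam y κ) B := by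
  simp only [jet22, jet21, jet20, jet12, jet11, smul_sub, Finset.smul_sum, ← Finset.sum_sub_distrib, ← Finset.sum_add_distrib]
  refine Finset.sum_congr rfl fun x _ => Finset.sum_congr rfl fun μ _ => Finset.sum_congr rfl fun ν _ => ?_
  exact ward22_plaqWord 𝕜 τ hτ e h B lam x μ ν

end Lattice

end Summit.QuantumFields.BalabanUV.Beta.WilsonFluctuationWard22
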